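import Summits.CriticalPhenomena.PercolationContinuityZ3.Theorems.PercNearOneGluingNoHeavyQuantSingleGateClosure
import HarnessLib

/-!
# QUANT lane R8, Route 1: CONJECTURE M-SGC (arm-2 g41) — the single-gate convolution closure is LINEAR IN THE CELL MATRIX:
# "a bi-mean matrix with admissible lines has an admissible antidiagonal"; `MatrixSGC ⟹ SingleGateConvClosed ⟹ … ⟹ FarTreeRow`

builds on p205010 (kernel theorem, internal audit signed; external expert review pending)

Statement + support file (`--supports stmt-CriticalPhenomena-4575`), QUANT lane typer seat prim-quant-stmt (gen 40), rung R8 of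
`run/shared/lean/prim/quant/LADDER.md`; README V422 ruling ("typer: type arm-2's M-SGC") and arm-2 g41's memo
`run/shared/lean/prim/quant/prim-quant-arm-2-g41/MATRIX-SGC-G41.md` §1/§3/§7.  Three small definitions (`rowMass`, `colMass`, `adiag` — bookkeeping of a
cell matrix on `{0..M₁} × {0..M₂}`), one `@[conjecture]` (`MatrixSGC`); theorems with standard axioms, no sorries.

THE RELAXATION (arm-2 g41).  `SingleGateConvClosed` (`…QuantSingleGateClosure`: two admissible factor laws `μ₁`, `μ₂` under one gate `q` have an
admissible gated convolution) only ever sees the rank-one cell matrix `μ₁(a)·μ₂(s)`.  Replace it by ANY nonnegative matrix `m` of total mass `1` whose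
ROWS all have mean `T₁` (as sub-probability laws: `Σ_a a·m(a,s) = T₁·|row s|`) and, normalised and gated, are DEC at floor `y` at every layer `< M₁`,
and whose COLUMNS likewise with `T₂`, `M₂`; ask that the gated ANTIDIAGONAL law `p ↦ Σ_{a+s=p} m(a,s)` be DEC at every layer `< M₁ + M₂`.
Bi-mean matrices span exactly `V₁ ⊗ V₂`, so nothing is lost linearly; what is forgotten is rank one (independence) inside the positive cone.
Probabilistic reading: `(A, S)` with `E[A | S] ≡ T₁`, `E[S | A] ≡ T₂` and admissible conditional laws ⟹ `A + S` admissible; SGC is the independent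
coupling.  By LP duality M-SGC at a configuration is the existence, for every product price system, of a CELLWISE certificate (row price systems +
column price systems + mean tilts; arm-2 g41's ✓ `flowAtT_gate_lconv_of_cellCert`, `…QuantSGCCellCertificate`).
EVIDENCE (arm-2 g41, exact cone / HiGHS alternating adversary; kit j242710, j242773, j242771, j242950, j242951, j243148): **0 / 10 060** adversarially
attacked configurations (M ≤ 12, q ∈ [.3, 1], every layer incl. dominant), exact all-layer certificates at the configurations where the NATURAL-LAYER
version fails.  EXACT NO-GO recorded there (not typed: it is not a statement about admissible factors): the variant constraining each line only at its
natural layer `j − s` is FALSE (three rational witnesses, rank-one maximisers whose empty line hides a failing factor layer).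

* `rowMass`, `colMass`, `adiag`; `adiag_mul_eq_lconv` (the rank-one matrix `μ₁ ⊗ μ₂` has antidiagonal law `lconv M₁ M₂ μ₁ μ₂`);
* **`@[conjecture] LawDec.MatrixSGC`**; **`singleGateConvClosed_of_matrixSGC : MatrixSGC → SingleGateConvClosed`** (the product matrix), hence
  `sdecConvClosed_of_matrixSGC`, `Quant.farTreeRow_of_matrixSGC`.

HONEST STATUS: `MatrixSGC`, `SingleGateConvClosed`, `SDECConvClosed`, `FarTreeRow` OPEN; RATE class log\* / honest sentence unchanged.  [this work]; the
conjecture and its census are prim-quant-arm-2 g41's.  Nothing here is cited as a published result.  The gluing rows served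
[cite: KozmaNitzan2024, Conjecture 3 (p. 15)]; product measure [cite: Grimmett1999, §1.3 p. 10].
-/

noncomputable section

open scoped BigOperators

namespace Summit.CriticalPhenomena.PercolationContinuityZ3.Theorems
namespace Quant
namespace LawDec

open Finset

/-- the mass of row `s` of a cell matrix on `{0..M₁} × {0..M₂}`: `Σ_{a ≤ M₁} m a s`. [this work] -/
def rowMass (M₁ : ℕ) (m : ℕ → ℕ → ℝ) (s : ℕ) : ℝ := ∑ a ∈ Finset.range (M₁ + 1), m a s

/-- the mass of column `a` of a cell matrix on `{0..M₁} × {0..M₂}`: `Σ_{s ≤ M₂} m a s`. [this work] -/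
def colMass (M₂ : ℕ) (m : ℕ → ℕ → ℝ) (a : ℕ) : ℝ := ∑ s ∈ Finset.range (M₂ + 1), m a s

/-- the ANTIDIAGONAL law of a cell matrix: `p ↦ Σ_{a ≤ M₁, s ≤ M₂, a + s = p} m a s` (the law of `A + S`). [this work] -/
def adiag (M₁ M₂ : ℕ) (m : ℕ → ℕ → ℝ) : ℕ → ℝ :=
  fun p => ∑ a ∈ Finset.range (M₁ + 1), ∑ s ∈ Finset.range (M₂ + 1), if a + s = p then m a s else 0

/-- the rank-one matrix `μ₁(a)·μ₂(s)` has antidiagonal law `lconv M₁ M₂ μ₁ μ₂` (by definition of `lconv`). [this work] -/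
theorem adiag_mul_eq_lconv (M₁ M₂ : ℕ) (μ₁ μ₂ : ℕ → ℝ) :
    adiag M₁ M₂ (fun a s => μ₁ a * μ₂ s) = lconv M₁ M₂ μ₁ μ₂ := rfl

/-- row masses of the rank-one matrix: `μ₂ s` (for `μ₁` of mass `1`). [this work] -/
theorem rowMass_mul (M₁ : ℕ) (μ₁ μ₂ : ℕ → ℝ) (h1 : ∑ a ∈ Finset.range (M₁ + 1), μ₁ a = 1) (s : ℕ) :
    rowMass M₁ (fun a s => μ₁ a * μ₂ s) s = μ₂ s := by
  simp only [rowMass]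
  rw [← Finset.sum_mul, h1, one_mul]

/-- column masses of the rank-one matrix: `μ₁ a` (for `μ₂` of mass `1`). [this work] -/
theorem colMass_mul (M₂ : ℕ) (μ₁ μ₂ : ℕ → ℝ) (h2 : ∑ s ∈ Finset.range (M₂ + 1), μ₂ s = 1) (a : ℕ) :
    colMass M₂ (fun a s => μ₁ a * μ₂ s) a = μ₁ a := by
  simp only [colMass]
  rw [← Finset.mul_sum, h2, mul_one]

/-- **CONJECTURE M-SGC (MATRIX SINGLE-GATE CLOSURE; prim-quant-arm-2 g41, MATRIX-SGC-G41 §3; typed by typer g40).**  For a floor `0 < y < 1`, a gate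
`0 < q ≤ 1`, tops `M₁`, `M₂`, line means `T₁`, `T₂` with `y·Mᵢ ≤ q·Tᵢ` (top-affordability at configuration level), and a nonnegative cell matrix
`m` on `{0..M₁} × {0..M₂}` of total mass `1` such that EVERY ROW `s` has mean `T₁` (`Σ_a a·m a s = T₁·rowMass s`) and, when charged, its
normalised gated law `gate (m · s / rowMass s) q` is DEC at floor `y` at every layer `L < M₁`, and EVERY COLUMN likewise with `T₂`, `M₂`: the gated
antidiagonal law `gate (adiag M₁ M₂ m) q` is DEC at floor `y` at every layer `j′ < M₁ + M₂`.  The rank-one matrix `μ₁ ⊗ μ₂` gives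
`SingleGateConvClosed` (`singleGateConvClosed_of_matrixSGC`), hence `SDECConvClosed`, `TreeBuiltDEC`, `GateMove`, `TreeDEC`, `Quant.FarTreeRow`.
EVIDENCE: 0 / 10 060 adversarial configurations (arm-2 g41; see the file header); the natural-layer-only variant is exactly false.
builds on p205010 (kernel theorem, internal audit signed; external expert review pending). [this work] [status: open] -/
@[conjecture] def MatrixSGC : Prop :=
  ∀ (y q T₁ T₂ : ℝ) (M₁ M₂ : ℕ) (m : ℕ → ℕ → ℝ),
    0 < y → y < 1 → 0 < q → q ≤ 1 →
    (∀ a s, 0 ≤ m a s) → (∀ a s, M₁ < a → m a s = 0) → (∀ a s, M₂ < s → m a s = 0) →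
    (∑ a ∈ Finset.range (M₁ + 1), ∑ s ∈ Finset.range (M₂ + 1), m a s = 1) →
    y * (M₁ : ℝ) ≤ q * T₁ → y * (M₂ : ℝ) ≤ q * T₂ →
    (∀ s, ∑ a ∈ Finset.range (M₁ + 1), (a : ℝ) * m a s = T₁ * rowMass M₁ m s) →
    (∀ a, ∑ s ∈ Finset.range (M₂ + 1), (s : ℝ) * m a s = T₂ * colMass M₂ m a) →
    (∀ s, 0 < rowMass M₁ m s → ∀ L, L < M₁ → DECAt y L M₁ (gate (fun a => m a s / rowMass M₁ m s) q)) →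
    (∀ a, 0 < colMass M₂ m a → ∀ L, L < M₂ → DECAt y L M₂ (gate (fun s => m a s / colMass M₂ m a) q)) →
    ∀ j', j' < M₁ + M₂ → DECAt y j' (M₁ + M₂) (gate (adiag M₁ M₂ m) q)

/-- **`M-SGC ⟹ SingleGateConvClosed`**: the rank-one matrix `m a s = μ₁ a · μ₂ s` of two admissible factors is a bi-mean matrix (row means
`mean μ₁`, column means `mean μ₂`) with admissible lines (each charged row, normalised, IS `μ₁`; each charged column IS `μ₂`), and its antidiagonal law
is `lconv M₁ M₂ μ₁ μ₂`. [this work] -/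
theorem singleGateConvClosed_of_matrixSGC (hM : MatrixSGC) : SingleGateConvClosed := by
  intro y q M₁ M₂ μ₁ μ₂ hy0 hy1 hq0 hq1 h10 h1M h11 hta1 h20 h2M h21 hta2 hD1 hD2 j' hj'
  rw [← adiag_mul_eq_lconv]
  refine hM y q (∑ h ∈ Finset.range (M₁ + 1), (h : ℝ) * μ₁ h) (∑ h ∈ Finset.range (M₂ + 1), (h : ℝ) * μ₂ h) M₁ M₂
    (fun a s => μ₁ a * μ₂ s) hy0 hy1 hq0 hq1 (fun a s => mul_nonneg (h10 a) (h20 s)) (fun a s ha => by simp only [h1M a ha, zero_mul])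
    (fun a s hs => by simp only [h2M s hs, mul_zero]) ?_ hta1 hta2 (fun s => ?_) (fun a => ?_) (fun s hs L hL => ?_) (fun a ha L hL => ?_) j' hj'
  · rw [← Finset.sum_mul_sum, h11, h21, one_mul]
  · rw [rowMass_mul M₁ μ₁ μ₂ h11 s]
    have e : ∀ a : ℕ, (a : ℝ) * (μ₁ a * μ₂ s) = ((a : ℝ) * μ₁ a) * μ₂ s := fun a => by ring
    simp_rw [e]
    rw [← Finset.sum_mul]
  · rw [colMass_mul M₂ μ₁ μ₂ h21 a]
    have e : ∀ s : ℕ, (s : ℝ) * (μ₁ a * μ₂ s) = μ₁ a * ((s : ℝ) * μ₂ s) := fun s => by ring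
    simp_rw [e]
    rw [← Finset.mul_sum, mul_comm]
  · rw [rowMass_mul M₁ μ₁ μ₂ h11 s] at hs ⊢
    have e : (fun a => μ₁ a * μ₂ s / μ₂ s) = μ₁ := funext fun a => mul_div_cancel_right₀ (μ₁ a) hs.ne'
    rw [e]; exact hD1 L hL
  · rw [colMass_mul M₂ μ₁ μ₂ h21 a] at ha ⊢
    have e : (fun s => μ₁ a * μ₂ s / μ₁ a) = μ₂ := funext fun s => by rw [mul_comm]; exact mul_div_cancel_right₀ (μ₂ s) ha.ne'
    rw [e]; exact hD2 L hL

/-- **`M-SGC ⟹ SDECConvClosed`**. [this work] -/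
theorem sdecConvClosed_of_matrixSGC (hM : MatrixSGC) : SDECConvClosed :=
  sdecConvClosed_of_singleGate (singleGateConvClosed_of_matrixSGC hM)

end LawDec

/-- **`M-SGC ⟹ Quant.FarTreeRow`** (through `SingleGateConvClosed`; unconditional reduction). [this work] -/
theorem farTreeRow_of_matrixSGC (hM : LawDec.MatrixSGC) : FarTreeRow :=
  farTreeRow_of_singleGate (LawDec.singleGateConvClosed_of_matrixSGC hM)

end Quant
end Summit.CriticalPhenomena.PercolationContinuityZ3.Theorems
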